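import Summits.AtomisticToContinuum.HydrodynamicLimit.Theorems.CollisionIsometryCLTCollisionalTransferLocalityMarkedReduction
import Summits.AtomisticToContinuum.HydrodynamicLimit.Theorems.CollisionIsometryCLTCollisionalTransferLocalityVirialBoundedRung0
import Summits.AtomisticToContinuum.HydrodynamicLimit.Theorems.CollisionIsometryCLTCollisionalTransferLocalityWeightedKineticRelaxationDilute
import Summits.AtomisticToContinuum.HydrodynamicLimit.Theorems.CollisionIsometryCLTCollisionalTransferLocalityEnergyAllTimes
import Summits.AtomisticToContinuum.HydrodynamicLimit.Theorems.CollisionIsometryCLTCollisionalTransferLocalityCompressibilityLinear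
import Summits.AtomisticToContinuum.HydrodynamicLimit.Theorems.CollisionIsometryCLTCollisionalTransferLocalityCeilingAllTimesRung0
import HarnessLib

/-!
# The marked Campbell law at global equilibrium (registered stub `stub_markedVirialConst_of_parts`, [MC0])
of the line `hemisphere-affine-slaving`, crux `CollisionalTransferLocality` (stmt-AtomisticToContinuum-9518)

The research stub [M] — the marked law at the collisional pressure, `sup_{τ ≤ t} |M_N − (Rhs_N + K_N)| → 0`
in local-Gibbs probability — AT GLOBAL EQUILIBRIUM (constant profiles `a₀ = 1`, `θ₀ = θ > 0`, `u₀ = 0`),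
obtained from

  h₁ = the equilibrium rung of the crux (`∀ θ > 0 ∃ σ₀ ∀ σ < σ₀ ∀ Φ, ConclusionAtFlow σ 1 θ 0 Φ`, i.e.
       `sup_{τ ≤ t} |Cc − Rhs| → 0` in probability for every kernel / horizon / tests, `conclusionAtFlow_iff`),
  h₂ = `FastMomentRelaxation` at equilibrium (`G_N{δ < ∫₀ᵗ∫ₓ ΣD² + ‖q‖²} → 0` for `0 < σ ≤ 1/2`),

both taken as HYPOTHESES, plus landed pieces.  It is the landed `stub_markedReduction`
(`…MarkedReduction.lean`) run BACKWARDS: on the good set `Cc = J_N` (`stub_balanceIdentity`), so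

  `M − (Rhs + K) = (Cc − Rhs) − (J − M) − K`, `|M − (Rhs + K)| ≤ |J − M| + |Cc − Rhs| + |K|`

with
* `|J − M| ≤ 27 C₂ ε_N V_N(τ) ≤ 27 C₂ ε_N V_N(t)` (`abs_Jfun_sub_Mfun_le`, `virialW_mono`,
  `exists_second_deriv_bound`), `ε_N → 0` (`tendsto_hsDiameter`), and `V_N(t)` tight at equilibrium
  (`virialBounded_const`, …VirialBoundedRung0);
* `sup_τ |Cc − Rhs|` small w.h.p. by h₁;
* `sup_τ |K|` small w.h.p. (`RelaxC`) by the landed [C] `stub_weightedKineticRelaxationDilute`, fed with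
  `stub_hsCompressibility_linear`, the energy bound `stub_energyAllTimes` (profiles `1, θ, 0` are
  `NiceProfiles`), the dilute block ceiling `ceilingAllTimes_const` and h₂.
The general-profile backward reduction is `markedVirial_of_conclusion` (the mirror image of
`stub_markedReduction`: the same union bound at levels `δ/3` off the null complement of the good set,
`measure_le_add_three_of_subset`, `localGibbsLaw_compl_good'`); the registered stub takes
`σ₀ := min (min σ_eq σ_V) (min σ_S (1/2))`.  No new definitions, no named facts, sorry-free.
-/

namespace Summit.AtomisticToContinuum.HydrodynamicLimit.Theorems.HemisphereAffineSlaving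

open scoped BigOperators Topology Classical ENNReal InnerProductSpace
open Filter Set Function MeasureTheory

noncomputable section

open Literature.MathematicalPhysics.KineticTheory (T3 V3)

/-- The elementary real-number step (backwards): if `c = j`, `|j − m| ≤ δ/3`, `|c − r| ≤ δ/3` and
`|k| ≤ δ/3` then `|m − (r + k)| ≤ δ` (`m − (r + k) = (c − r) + (m − j) + (−k)`). [folklore] -/
private theorem abs_marked_le_of_parts {c r j m k δ : ℝ} (hcj : c = j)
    (h1 : |j - m| ≤ δ / 3) (h2 : |c - r| ≤ δ / 3) (h3 : |k| ≤ δ / 3) : |m - (r + k)| ≤ δ := by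
  have key : m - (r + k) = (c - r) + (m - j) + (-k) := by rw [hcj]; ring
  rw [key]
  calc |(c - r) + (m - j) + (-k)| ≤ |c - r| + |m - j| + |-k| := abs_add_three _ _ _
    _ ≤ δ / 3 + δ / 3 + δ / 3 := by
        rw [abs_sub_comm m j, abs_neg]
        exact add_le_add (add_le_add h2 h1) h3
    _ = δ := by ring

/-- A positive `ℝ≥0∞` budget contains a positive real budget. [folklore] -/
private theorem exists_ofReal_le_of_pos' {e : ℝ≥0∞} (he : 0 < e) :
    ∃ e' : ℝ, 0 < e' ∧ ENNReal.ofReal e' ≤ e := by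
  rcases eq_or_ne e ⊤ with h | h
  · exact ⟨1, one_pos, h ▸ le_top⟩
  · refine ⟨e.toReal, ENNReal.toReal_pos he.ne' h, ?_⟩
    rw [ENNReal.ofReal_toReal h]

/-- **The marked reduction run backwards** (general profiles). At fixed `(σ, profiles, Φ)` with
`0 < σ ≤ 1/2`, a kernel family, a horizon `t > 0` and smooth space–time tests on `[0, t]`:
[S1] `BalanceFor σ Φ` (`Cc = J_N` on the good set) ∧ [V] `VirialBounded` ∧ the crux's conclusion at this
`(kernel, t, ψ, χ)` (`sup_{τ ≤ t} |Cc − Rhs| → 0` in probability) ∧ [C] `RelaxC` (`sup_{τ ≤ t} |K| → 0`)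
⟹ [M] the marked law at the collisional pressure: `sup_{τ ≤ t} |M_N − (Rhs_N + K_N)| → 0` in local-Gibbs
probability.  On the good set `M − (Rhs + K) = (Cc − Rhs) + (M − J) − K` with
`|J_N − M_N| ≤ 27 C₂ ε_N V_N(τ) ≤ 27 C₂ ε_N V_N(t)` (`abs_Jfun_sub_Mfun_le`, `virialW_mono`,
`exists_second_deriv_bound`); `ε_N → 0` (`tendsto_hsDiameter`) against a tightness level of `V_N(t)`,
the null complement of the good set (`localGibbsLaw_compl_good'`) and a union bound at levels `δ/3`
(`measure_le_add_three_of_subset`) — verbatim the bookkeeping of `stub_markedReduction`. [folklore] -/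
theorem markedVirial_of_conclusion {σ : ℝ} (hσ : 0 < σ) (hσ2 : σ ≤ 1 / 2) {a₀ θ₀ : T3 → ℝ}
    {u₀ : T3 → V3} (Φ : Flows σ) (hBal : BalanceFor σ Φ) (φ : ℕ → T3 → ℝ) {t : ℝ} (ht : 0 < t)
    {ψ : ℝ → T3 → V3} {χ : ℝ → T3 → ℝ}
    (hψ : Literature.Analysis.FunctionSpaces.Torus.IsSmoothSpaceTimeOn (Icc 0 t) ψ)
    (hχ : Literature.Analysis.FunctionSpaces.Torus.IsSmoothSpaceTimeOn (Icc 0 t) χ)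
    (hV : VirialBounded σ a₀ θ₀ u₀ Φ t)
    (hE : ∀ δ : ℝ, 0 < δ → Tendsto (fun N : ℕ =>
      Literature.MathematicalPhysics.KineticTheory.localGibbsLaw σ a₀ u₀ θ₀ N (Φ N)
        {z | ∃ τ ∈ Icc 0 t, δ < |Cc σ Φ ψ χ N z τ - Rhs σ Φ φ ψ χ N z τ|}) atTop (𝓝 0))
    (hC : RelaxC σ a₀ θ₀ u₀ Φ φ t ψ χ) :
    ∀ δ : ℝ, 0 < δ → Tendsto (fun N : ℕ =>
      Literature.MathematicalPhysics.KineticTheory.localGibbsLaw σ a₀ u₀ θ₀ N (Φ N)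
        {z | ∃ τ ∈ Icc 0 t, δ < |Mfun σ Φ ψ χ N z τ -
          (Rhs σ Φ φ ψ χ N z τ + Kfun σ Φ φ ψ χ N z τ)|}) atTop (𝓝 0) := by
  intro δ hδ
  obtain ⟨C₂, hC₂, hCψ, hCχ⟩ := exists_second_deriv_bound ht hψ hχ
  have hδ3 : 0 < δ / 3 := by positivity
  set P : (N : ℕ) → Measure (Cfg N) :=
    fun N => Literature.MathematicalPhysics.KineticTheory.localGibbsLaw σ a₀ u₀ θ₀ N (Φ N) with hP
  -- the two random parts at level `δ/3`
  set A : (N : ℕ) → Set (Cfg N) := fun N =>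
    {z | ∃ τ ∈ Icc 0 t, δ / 3 < |Cc σ Φ ψ χ N z τ - Rhs σ Φ φ ψ χ N z τ|} with hA
  set D : (N : ℕ) → Set (Cfg N) := fun N =>
    {z | ∃ τ ∈ Icc 0 t, δ / 3 < |Kfun σ Φ φ ψ χ N z τ|} with hD
  have hAlim : Tendsto (fun N => P N (A N)) atTop (𝓝 0) := hE (δ / 3) hδ3
  have hDlim : Tendsto (fun N => P N (D N)) atTop (𝓝 0) := hC (δ / 3) hδ3
  refine ENNReal.tendsto_nhds_zero.2 fun e he => ?_
  -- a real budget `e' ≤ e`, split in three thirds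
  obtain ⟨e', he'0, he'e⟩ := exists_ofReal_le_of_pos' he
  have he'3 : 0 < e' / 3 := by positivity
  obtain ⟨K, hK⟩ := hV (e' / 3) he'3
  set K' : ℝ := max K 1 with hK'
  have hK'0 : 0 < K' := lt_of_lt_of_le one_pos (le_max_right _ _)
  set B : (N : ℕ) → Set (Cfg N) := fun N => {z | K < virialW σ Φ N z t} with hB
  -- eventually `27 C₂ ε_N K' < δ/3`
  have hεlim : Tendsto (fun N : ℕ =>
      27 * C₂ * Literature.MathematicalPhysics.KineticTheory.hsDiameter σ N * K') atTop (𝓝 0) := by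
    have h := ((Literature.MathematicalPhysics.KineticTheory.tendsto_hsDiameter σ).const_mul
      (27 * C₂)).mul_const K'
    simpa using h
  have h1 : ∀ᶠ N : ℕ in atTop,
      27 * C₂ * Literature.MathematicalPhysics.KineticTheory.hsDiameter σ N * K' < δ / 3 :=
    hεlim.eventually (gt_mem_nhds hδ3)
  have h2 : ∀ᶠ N : ℕ in atTop, P N (A N) ≤ ENNReal.ofReal (e' / 3) :=
    ((tendsto_order.1 hAlim).2 _ (ENNReal.ofReal_pos.2 he'3)).mono fun N hN => hN.le
  have h3 : ∀ᶠ N : ℕ in atTop, P N (D N) ≤ ENNReal.ofReal (e' / 3) :=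
    ((tendsto_order.1 hDlim).2 _ (ENNReal.ofReal_pos.2 he'3)).mono fun N hN => hN.le
  filter_upwards [h1, h2, h3, hK] with N hN1 hN2 hN3 hN4
  -- the union bound at this `N`
  have hcover : {z : Cfg N | ∃ τ ∈ Icc 0 t, δ < |Mfun σ Φ ψ χ N z τ -
      (Rhs σ Φ φ ψ χ N z τ + Kfun σ Φ φ ψ χ N z τ)|} ⊆ (Φ N).goodᶜ ∪ (A N ∪ (B N ∪ D N)) := by
    rintro z ⟨τ, hτ, hzδ⟩
    by_cases hz : z ∈ (Φ N).good
    · right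
      by_contra hno
      simp only [Set.mem_union, hA, hB, hD, Set.mem_setOf_eq, not_or, not_exists, not_and, not_lt] at hno
      obtain ⟨hnA, hnB, hnD⟩ := hno
      have hcj : Cc σ Φ ψ χ N z τ = Jfun σ Φ ψ χ N z τ := hBal N t ht ψ χ hψ hχ z hz τ hτ
      have hkin := abs_Jfun_sub_Mfun_le hσ hσ2 Φ hz hC₂
        (fun s hs a => (hψ.isSmooth_slice hs).apply a) (fun s hs => hχ.isSmooth_slice hs) hCψ hCχ hτ
      have hmono : virialW σ Φ N z τ ≤ virialW σ Φ N z t := virialW_mono hσ Φ hz hτ.2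
      have hVK : virialW σ Φ N z t ≤ K' := hnB.trans (le_max_left _ _)
      have hcoef : 0 ≤ 27 * C₂ * Literature.MathematicalPhysics.KineticTheory.hsDiameter σ N := by
        have := Literature.MathematicalPhysics.KineticTheory.hsDiameter_pos hσ N; positivity
      have hJM : |Jfun σ Φ ψ χ N z τ - Mfun σ Φ ψ χ N z τ| ≤ δ / 3 :=
        calc _ ≤ 27 * C₂ * Literature.MathematicalPhysics.KineticTheory.hsDiameter σ N *
              virialW σ Φ N z τ := hkin
          _ ≤ 27 * C₂ * Literature.MathematicalPhysics.KineticTheory.hsDiameter σ N * K' :=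
              mul_le_mul_of_nonneg_left (hmono.trans hVK) hcoef
          _ ≤ δ / 3 := hN1.le
      have hle := abs_marked_le_of_parts hcj hJM (hnA τ hτ) (hnD τ hτ)
      exact absurd hzδ (not_lt.2 hle)
    · exact Or.inl hz
  calc P N {z | ∃ τ ∈ Icc 0 t, δ < |Mfun σ Φ ψ χ N z τ - (Rhs σ Φ φ ψ χ N z τ + Kfun σ Φ φ ψ χ N z τ)|}
      ≤ P N (A N) + (P N (B N) + P N (D N)) :=
        measure_le_add_three_of_subset _ (by rw [hP]; exact localGibbsLaw_compl_good' (Φ N)) hcover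
    _ ≤ ENNReal.ofReal (e' / 3) + (ENNReal.ofReal (e' / 3) + ENNReal.ofReal (e' / 3)) :=
        add_le_add hN2 (add_le_add hN4 hN3)
    _ = ENNReal.ofReal e' := by
        rw [← ENNReal.ofReal_add he'3.le he'3.le, ← ENNReal.ofReal_add he'3.le (by positivity)]
        congr 1; ring
    _ ≤ e := he'e

/-- **Registered stub `stub_markedVirialConst_of_parts`** ([MC0]) of crux stmt-AtomisticToContinuum-9518
(line hemisphere-affine-slaving, instance B): THE MARKED CAMPBELL LAW [M] AT GLOBAL EQUILIBRIUM.  From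
h₁ = the equilibrium rung of the crux (`ConclusionAtFlow σ 1 θ 0 Φ` for all small `σ` and all `Φ`) and
h₂ = `FastMomentRelaxation` at equilibrium (both hypotheses): for every `θ > 0` there is `σ₀ > 0` such that
for `0 < σ < σ₀`, every flow family, horizon `t > 0`, admissible kernel family and smooth tests on `[0, t]`,
`sup_{τ ≤ t} |M_N − (Rhs_N + K_N)| → 0` in probability under the homogeneous Gibbs laws `G_N = localGibbsLaw σ 1 0 θ`.
Proof: `σ₀ := min (min σ_eq σ_V) (min σ_S (1/2))` with `σ_eq` from h₁, `σ_V` from `virialBounded_const`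
([V] at equilibrium) and `σ_S` from `ceilingAllTimes_const` (dilute block ceiling at level `ηZ` of
`stub_hsCompressibility_linear`); then `markedVirial_of_conclusion` with [S1] `stub_balanceIdentity`,
[V], h₁ unfolded by `conclusionAtFlow_iff`, and [C] `RelaxC` from `stub_weightedKineticRelaxationDilute`
(energy bound `stub_energyAllTimes` at the nice profiles `1, θ, 0`, the ceiling, and h₂). [folklore] -/
theorem stub_markedVirialConst_of_parts : (∀ θ : ℝ, 0 < θ → ∃ σ₀ : ℝ, 0 < σ₀ ∧ ∀ σ : ℝ, 0 < σ → σ < σ₀ → ∀ Φ : Flows σ, ConclusionAtFlow σ (fun _ => 1) (fun _ => θ) (fun _ => 0) Φ) → (∀ σ : ℝ, 0 < σ → σ ≤ 1 / 2 → ∀ θ : ℝ, 0 < θ → ∀ (Φ : Flows σ) (γ C : ℝ) (φ : ℕ → T3 → ℝ), 0 < γ → γ ≤ 1 / 15 → AdmissibleKernel γ C φ → ∀ t : ℝ, 0 < t → ∀ δ : ℝ, 0 < δ → Tendsto (fun N : ℕ => Literature.MathematicalPhysics.KineticTheory.localGibbsLaw σ (fun _ => 1) (fun _ => 0) (fun _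 => θ) N (Φ N) {z | δ < ∫ s in Icc 0 t, ∫ x, ((∑ j, ∑ k, Dst φ N ((Φ N).flow s z) x j k ^ 2) + ‖qfl φ N ((Φ N).flow s z) x‖ ^ 2)}) atTop (𝓝 0)) → ∀ θ : ℝ, 0 < θ → ∃ σ₀ : ℝ, 0 < σ₀ ∧ ∀ σ : ℝ, 0 < σ → σ < σ₀ → ∀ (Φ : Flows σ) (t : ℝ), 0 < t → ∀ (γ C : ℝ) (φ : ℕ → T3 → ℝ), 0 < γ → γ ≤ 1 / 15 → AdmissibleKernel γ C φ → ∀ (ψ : ℝ → T3 → V3) (χ : ℝ → T3 → ℝ), Literature.Analysis.FunctionSpaces.Torus.IsSmoothSpaceTimeOn (Icc 0 t) ψ → Literature.Analysis.FunctionSpaces.Torus.IsSmoothSpaceTimeOn (Icc 0 t) χ → ∀ δ : ℝ, 0 < δ → Tendsto (fun N : ℕ => Literature.MathematicalPhysics.KineticTheory.localGibbsLaw σ (fun _ => 1) (fun _ => 0) (fun _ => θ) N (Φ N) {z | ∃ τ ∈ Icc 0 t, δ < |Mfun σ Φ ψ χ N z τ - (Rhs σ Φ φ ψ χ N z τ +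 Kfun σ Φ φ ψ χ N z τ)|}) atTop (𝓝 0) := by
  intro h₁ h₂ θ hθ
  -- the four thresholds: equilibrium rung, virial tightness, dilute ceiling, `1/2`
  obtain ⟨σeq, hσeq, Heq⟩ := h₁ θ hθ
  obtain ⟨σV, hσV, HV⟩ := virialBounded_const (a := 1) (θ := θ) one_pos hθ 0
  obtain ⟨ηZ, hηZ, K, hK0, hZK⟩ := stub_hsCompressibility_linear
  obtain ⟨σS, hσS, HS⟩ := ceilingAllTimes_const ηZ hηZ θ hθ
  refine ⟨min (min σeq σV) (min σS (1 / 2)),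
    lt_min (lt_min hσeq hσV) (lt_min hσS one_half_pos), ?_⟩
  intro σ hσ hσlt Φ t ht γ C φ hγ hγ' hadm ψ χ hψ hχ
  have hσeq' : σ < σeq := lt_of_lt_of_le hσlt ((min_le_left _ _).trans (min_le_left _ _))
  have hσV' : σ < σV := lt_of_lt_of_le hσlt ((min_le_left _ _).trans (min_le_right _ _))
  have hσS' : σ < σS := lt_of_lt_of_le hσlt ((min_le_right _ _).trans (min_le_left _ _))
  have hσ2 : σ ≤ 1 / 2 := (lt_of_lt_of_le hσlt ((min_le_right _ _).trans (min_le_right _ _))).le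
  -- [S1], [V], the equilibrium rung at this `(kernel, t, ψ, χ)`
  have hBal : BalanceFor σ Φ := stub_balanceIdentity σ hσ hσ2 Φ
  have hV : VirialBounded σ (fun _ => 1) (fun _ => θ) (fun _ => 0) Φ t := HV σ hσ hσV' Φ t ht
  have hE := (conclusionAtFlow_iff σ (fun _ => 1) (fun _ => θ) (fun _ => 0) Φ).1 (Heq σ hσ hσeq' Φ)
    γ C φ hγ hγ' hadm t ht ψ χ hψ hχ
  -- [C] from the landed dilute weighted kinetic relaxation
  have hP : NiceProfiles (fun _ : T3 => (1 : ℝ)) (fun _ => θ) (fun _ => (0 : V3)) :=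
    ⟨continuous_const, continuous_const, continuous_const, fun _ => one_pos, fun _ => hθ⟩
  obtain ⟨E₀, -, hEner⟩ := stub_energyAllTimes (fun _ => 1) (fun _ => θ) (fun _ => 0) hP σ hσ hσ2 Φ
  have hDil : DiluteAt σ (fun _ => 1) (fun _ => θ) (fun _ => 0) Φ t φ ηZ :=
    HS σ hσ hσS' Φ t ht γ C φ hγ hγ' hadm
  have hFloc := h₂ σ hσ hσ2 θ hθ Φ γ C φ hγ hγ' hadm t ht
  have hC : RelaxC σ (fun _ => 1) (fun _ => θ) (fun _ => 0) Φ φ t ψ χ :=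
    stub_weightedKineticRelaxationDilute ηZ K hηZ hK0 hZK ηZ hηZ le_rfl σ hσ (fun _ => 1) (fun _ => θ)
      (fun _ => 0) Φ t E₀ ht (hEner t) γ C φ hγ hγ' hadm hDil hFloc ψ χ hψ hχ
  exact markedVirial_of_conclusion hσ hσ2 Φ hBal φ ht hψ hχ hV hE hC

end

end Summit.AtomisticToContinuum.HydrodynamicLimit.Theorems.HemisphereAffineSlaving
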